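import Literature.Geometry.Riemannian.ColdingAlmostOrthogonalFrame
import Literature.Geometry.Riemannian.ColdingSyntheticIsometry
import Literature.Geometry.Riemannian.ColdingSyntheticSphereMap
import Literature.Geometry.Riemannian.RoundSphereGHApproxOfDense
import Literature.Geometry.Riemannian.BishopGromovVolumeComparison
import Mathlib.Analysis.SpecialFunctions.Pow.Continuity
import HarnessLib

/-!
# Colding's volume sphere theorem: `Colding1996_volume_ghClose` holds

T. H. Colding, *Shape of manifolds with positive Ricci curvature*, Invent. Math. 124 (1996),
Main Theorem: for `n ≥ 2` and `ε > 0` there is `δ = δ(n, ε) > 0` such that a closed Riemannian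
`n`-manifold with `Ric ≥ n − 1` and `vol ≥ (1 − δ) vol(Sⁿ)` is `ε`-Gromov–Hausdorff close to the
round sphere. This file assembles the proof of the tree's named fact `Colding1996_volume_ghClose`
(`theorem Colding1996_volume_ghClose_holds`) from the bricks proved in the sibling files:

* A0–A2 (Colding §1): the `L²`-Toponogov estimate for the functions `cos d_p` along almost every
  minimizing segment, uniform in the volume deficit, and its consequence Lemma 2.10
  (`exists_deficit_forall_good_geodesics_and_antipodes`: common good geodesics for finitely many
  base points near every pair, and almost antipodes);
* A3 (Colding §2), here: an almost orthogonal frame `x_0, …, x_n`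
  (`exists_almost_orthogonal_frame`), its cosine coordinates `Φ = (cos d(x_i, ·))_i : M → ℝⁿ⁺¹`,
  Bessel `‖Φ‖ ≤ 1 + ψ` everywhere (synthesis, `ColdingSynthetic.exists_cos_dist_realization`),
  Parseval `‖Φ‖² ≥ 1 − ψ` everywhere (second moments `∫ cos² d_p ≥ vol(Sⁿ)/(n+1) − ψ`, Markov,
  relative volume comparison, Lipschitz), the almost isometry `cos d(y, z) ≈ ⟨Φ y, Φ z⟩`
  (analysis, `ColdingSynthetic.abs_cos_dist_sub_sum_le`), and finally `f = Φ/‖Φ‖ : M → Sⁿ`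
  distorts `d` against `∠` by `≤ ε` and is `ε`-onto (`IsRoundSphereGHApprox`).

The paper itself being unavailable to the formalizer beyond its architecture (Colding 1997,
*Aspects*, and Hu–Yin 2015 restate Lemma 2.10 and the strategy), §2 is carried out along an
explicit elementary route (frames by second moments, synthesis/analysis inductions with explicit
constants) recorded in the sibling files; the statement proved is exactly the tree's.

Everything here is proved; no new definitions of facts (D-0026).

## References

* T. H. Colding, *Shape of manifolds with positive Ricci curvature*, Invent. Math. 124 (1996)
  175–191, Main Theorem, Lemma 2.10, §2. [Colding1996Shape]
* T. H. Colding, *Aspects of Ricci curvature*, in: Comparison Geometry, MSRI Publ. 30 (1997),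
  83–98, Thm. 2.2 and its proof sketch. [Colding1997Aspects]
-/

noncomputable section

open Bundle Set Function Filter MeasureTheory Manifold InnerProductGeometry
open scoped Manifold ContDiff Topology ENNReal BigOperators RealInnerProductSpace

namespace Literature.Geometry.Riemannian

/-! ### Synthetic complements -/

namespace ColdingSynthetic

variable {M : Type*} [PseudoMetricSpace M]

/-- **Bessel from synthesis.** If every unit vector `c` is realised by a point `q` with
`|cos d(w, q) − Σ_i cos d(x_i, w) c_i| ≤ E`, then `√(Σ_i cos² d(x_i, w)) ≤ 1 + E`
(take `c = Φ(w)/‖Φ(w)‖`). [cite: Colding1996Shape, §2] -/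
theorem sqrt_sum_cos_sq_le_of_realization {ι : Type*} [Fintype ι] [Nonempty ι] (x : ι → M) (w : M)
    {E : ℝ} (hreal : ∀ c : ι → ℝ, ∑ i, c i ^ 2 = 1 →
      ∃ q : M, |Real.cos (dist w q) - ∑ i, Real.cos (dist (x i) w) * c i| ≤ E) :
    Real.sqrt (∑ i, Real.cos (dist (x i) w) ^ 2) ≤ 1 + E := by
  classical
  set F : ℝ := ∑ i, Real.cos (dist (x i) w) ^ 2 with hF
  set N : ℝ := Real.sqrt F with hN
  have hF0 : 0 ≤ F := Finset.sum_nonneg fun i _ ↦ sq_nonneg _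
  have hN0 : 0 ≤ N := Real.sqrt_nonneg _
  have hN2 : N ^ 2 = F := Real.sq_sqrt hF0
  by_cases hN00 : N = 0
  · -- `F = 0`: realise a basis vector to see `-1 ≤ E`
    obtain ⟨i₀⟩ := ‹Nonempty ι›
    obtain ⟨q, hq⟩ := hreal (fun i ↦ if i = i₀ then 1 else 0) (by
      simp [apply_ite (· ^ 2), Finset.sum_ite_eq'])
    have h4 : ∑ i, Real.cos (dist (x i) w) * (if i = i₀ then (1:ℝ) else 0) =
        Real.cos (dist (x i₀) w) := by
      simp [mul_ite, Finset.sum_ite_eq']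
    rw [h4] at hq
    have h5 := (abs_le.1 hq).1
    have h6 := Real.cos_le_one (dist w q)
    have h8 : Real.cos (dist (x i₀) w) ^ 2 ≤ F :=
      Finset.single_le_sum (fun i _ ↦ sq_nonneg (Real.cos (dist (x i) w))) (Finset.mem_univ i₀)
    have h9 : F = 0 := by rw [← hN2, hN00]; ring
    have h10 : Real.cos (dist (x i₀) w) = 0 := by
      rw [h9] at h8; exact pow_eq_zero_iff two_ne_zero |>.1 (le_antisymm h8 (sq_nonneg _))
    rw [h10] at h5
    rw [hN00]
    linarith
  · have hNpos : 0 < N := lt_of_le_of_ne hN0 (Ne.symm hN00)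
    set c : ι → ℝ := fun i ↦ Real.cos (dist (x i) w) / N with hc
    have hc1 : ∑ i, c i ^ 2 = 1 := by
      simp only [hc, div_pow]
      rw [← Finset.sum_div, ← hF, ← hN2, div_self (pow_ne_zero 2 hN00)]
    obtain ⟨q, hq⟩ := hreal c hc1
    have h1 : ∑ i, Real.cos (dist (x i) w) * c i = N := by
      simp only [hc]
      have h2 : ∀ i, Real.cos (dist (x i) w) * (Real.cos (dist (x i) w) / N) =
          Real.cos (dist (x i) w) ^ 2 / N := fun i ↦ by ring
      simp_rw [h2]
      rw [← Finset.sum_div, ← hF, ← hN2, sq, mul_div_assoc, div_self hN00, mul_one]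
    rw [h1] at hq
    have h3 := (abs_le.1 hq).1
    have h4 := Real.cos_le_one (dist w q)
    linarith

/-- `F = Σ_i cos² d(x_i, ·)` is `2 · card`-Lipschitz. [folklore] -/
theorem abs_sum_cos_sq_sub_sum_cos_sq_le {ι : Type*} [Fintype ι] (x : ι → M) (p s : M) :
    |∑ i, Real.cos (dist (x i) p) ^ 2 - ∑ i, Real.cos (dist (x i) s) ^ 2| ≤
      2 * Fintype.card ι * dist p s := by
  rw [← Finset.sum_sub_distrib]
  refine (Finset.abs_sum_le_sum_abs _ _).trans ?_
  have h1 : ∀ i ∈ Finset.univ, |Real.cos (dist (x i) p) ^ 2 - Real.cos (dist (x i) s) ^ 2| ≤ 2 * dist p s := by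
    intro i _
    rw [sq_sub_sq, abs_mul]
    have h2 : |Real.cos (dist (x i) p) + Real.cos (dist (x i) s)| ≤ 2 := by
      refine (abs_add_le _ _).trans ?_
      have := Real.abs_cos_le_one (dist (x i) p)
      have := Real.abs_cos_le_one (dist (x i) s)
      linarith
    have h3 := abs_cos_dist_sub_cos_dist_le (x i) p s
    exact mul_le_mul h2 h3 (abs_nonneg _) zero_le_two
  refine (Finset.sum_le_card_nsmul _ _ _ h1).trans ?_
  rw [Finset.card_univ, nsmul_eq_mul]
  exact le_of_eq (by ring)

end ColdingSynthetic

/-! ### The choice of the coarse parameter `γ` -/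

/-- The coarse error of the assembly as a function of `γ`: `T(γ) = 5ⁿ⁺¹ D(γ) + 2γ` with
`D(γ) = π√(γ/2) + η₂(γ) + γ + n √(2γ + γ/2)`, `η₂(γ) = ψ₀ + (2nπⁿ⁻¹ψ₀)^{1/n}`, `ψ₀ = π√(γ/2)`;
it is continuous and vanishes at `γ = 0`, whence a `γ ∈ (0, 1]` with `T(γ) < c`,
`π√(γ/2) < π/(2n)`. [folklore] -/
theorem exists_coarse_parameter (n : ℕ) (hn : 1 ≤ n) {c : ℝ} (hc : 0 < c) :
    ∃ γ : ℝ, 0 < γ ∧ γ ≤ 1 ∧ Real.pi * Real.sqrt (γ / 2) < Real.pi / (2 * n) ∧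
      5 ^ (n + 1) * (Real.pi * Real.sqrt (γ / 2) +
        (Real.pi * Real.sqrt (γ / 2) +
          (2 * n * Real.pi ^ (n - 1) * (Real.pi * Real.sqrt (γ / 2))) ^ ((n : ℝ)⁻¹)) +
        γ + n * Real.sqrt (2 * γ + γ / 2)) + 2 * γ < c := by
  have hninv : 0 ≤ (n : ℝ)⁻¹ := by positivity
  have hn0 : (n : ℝ)⁻¹ ≠ 0 := by positivity
  have hT_cont : Continuous fun γ : ℝ ↦ 5 ^ (n + 1) * (Real.pi * Real.sqrt (γ / 2) +
        (Real.pi * Real.sqrt (γ / 2) +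
          (2 * n * Real.pi ^ (n - 1) * (Real.pi * Real.sqrt (γ / 2))) ^ ((n : ℝ)⁻¹)) +
        γ + n * Real.sqrt (2 * γ + γ / 2)) + 2 * γ := by
    fun_prop (disch := positivity)
  have hsq : Continuous fun γ : ℝ ↦ Real.pi * Real.sqrt (γ / 2) := by fun_prop
  have h1 : ∀ᶠ γ in 𝓝 (0:ℝ), 5 ^ (n + 1) * (Real.pi * Real.sqrt (γ / 2) +
        (Real.pi * Real.sqrt (γ / 2) +
          (2 * n * Real.pi ^ (n - 1) * (Real.pi * Real.sqrt (γ / 2))) ^ ((n : ℝ)⁻¹)) +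
        γ + n * Real.sqrt (2 * γ + γ / 2)) + 2 * γ < c :=
    hT_cont.continuousAt.eventually_lt continuousAt_const (by simpa [Real.zero_rpow hn0] using hc)
  have h2 : ∀ᶠ γ in 𝓝 (0:ℝ), Real.pi * Real.sqrt (γ / 2) < Real.pi / (2 * n) :=
    hsq.continuousAt.eventually_lt continuousAt_const (by
      have : (0:ℝ) < Real.pi / (2 * n) := by
        have : (0:ℝ) < n := by exact_mod_cast hn
        positivity
      simpa using this)
  have h3 : ∀ᶠ γ in 𝓝 (0:ℝ), γ < 1 := Iio_mem_nhds zero_lt_one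
  have h4 : ∀ᶠ γ in 𝓝[>] (0:ℝ), 0 < γ := self_mem_nhdsWithin
  obtain ⟨γ, hγ0, ⟨⟨hγ1, hγ2⟩, hγ3⟩⟩ :=
    (h4.and (((h1.and h2).and h3).filter_mono nhdsWithin_le_nhds)).exists
  exact ⟨γ, hγ0, hγ3.le, hγ2, hγ1⟩

/-- The fine parameter: finitely many constraints `f_k(ε') < b_k` with `f_k` continuous,
`f_k(0) = 0 < b_k`. [folklore] -/
theorem exists_fine_parameter (n : ℕ) {γ sg ε b₇ : ℝ} (hγ : 0 < γ) (hsg : 0 < sg) (hε : 0 < ε)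
    (hb₇ : 0 < b₇) :
    ∃ ε' : ℝ, 0 < ε' ∧ 20 ^ (n + 2) * ε' < 1 ∧ 3 * (20 ^ (n + 1) * ε') < γ / 4 ∧
      Real.pi * (Real.sqrt (n + 1) * (20 ^ (n + 1) * ε')) < ε ∧ 3 * ε' < γ / 2 ∧
      6 * ε' < sg / 2 ∧ n * (n * (6 * ε' / sg) / sg ^ n) ^ 2 < γ / 2 ∧
      5 ^ (n + 1) * (4 * (n + 3) * (6 * ε' / sg)) < γ ∧ 3 * (20 ^ (n + 1) * ε') < b₇ := by
  have key : ∀ {f : ℝ → ℝ} {b : ℝ}, Continuous f → f 0 = 0 → 0 < b → ∀ᶠ t in 𝓝 (0:ℝ), f t < b :=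
    fun hf h0 hb ↦ hf.continuousAt.eventually_lt continuousAt_const (by rw [h0]; exact hb)
  have e1 := key (f := fun t ↦ 20 ^ (n + 2) * t) (by fun_prop) (by simp) one_pos
  have e2 := key (f := fun t ↦ 3 * (20 ^ (n + 1) * t)) (by fun_prop) (by simp)
    (by positivity : 0 < γ / 4)
  have e3 := key (f := fun t ↦ Real.pi * (Real.sqrt (n + 1) * (20 ^ (n + 1) * t))) (by fun_prop)
    (by simp) hε
  have e4 := key (f := fun t ↦ 3 * t) (by fun_prop) (by simp) (by positivity : 0 < γ / 2)
  have e5 := key (f := fun t ↦ 6 * t) (by fun_prop) (by simp) (by positivity : 0 < sg / 2)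
  have e6 := key (f := fun t ↦ n * (n * (6 * t / sg) / sg ^ n) ^ 2) (by fun_prop) (by simp)
    (by positivity : 0 < γ / 2)
  have e7 := key (f := fun t ↦ 5 ^ (n + 1) * (4 * (n + 3) * (6 * t / sg))) (by fun_prop) (by simp) hγ
  have e8 := key (f := fun t ↦ 3 * (20 ^ (n + 1) * t)) (by fun_prop) (by simp) hb₇
  have h0 : ∀ᶠ t in 𝓝[>] (0:ℝ), 0 < t := self_mem_nhdsWithin
  obtain ⟨t, ht⟩ :=
    (h0.and ((((((((e1.and e2).and e3).and e4).and e5).and e6).and e7).and e8).filter_mono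
      nhdsWithin_le_nhds)).exists
  obtain ⟨ht0, ⟨⟨⟨⟨⟨⟨⟨ht1, ht2⟩, ht3⟩, ht4⟩, ht5⟩, ht6⟩, ht7⟩, ht8⟩⟩ := ht
  exact ⟨t, ht0, ht1, ht2, ht3, ht4, ht5, ht6, ht7, ht8⟩


/-! ### The theorem -/

section Assembly

open Lorentzian Lorentzian.PseudoRiemannianMetric
open Literature.Geometry.Lorentzian (riemannianMeasure)

/-- **Colding's volume sphere theorem** (Colding 1996, Main Theorem): the named fact
`Colding1996_volume_ghClose` holds — for `n ≥ 2` and `ε > 0` there is `δ > 0` such that every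
compact connected `C^∞` Riemannian `n`-manifold with `Ric ≥ (n − 1) g` and
`vol ≥ (1 − δ) vol(Sⁿ)` admits an `ε`-Gromov–Hausdorff approximation to the unit round sphere.
See the module docstring for the architecture of the proof. [cite: Colding1996Shape, Main Theorem] -/
theorem Colding1996_volume_ghClose_holds : Colding1996_volume_ghClose := by
  intro n hn ε hε
  classical
  have hn1 : 1 ≤ n := by omega
  have hKn : (2:ℝ) ≤ n := by exact_mod_cast hn
  -- (1) the coarse parameter `γ` and the derived constants
  have hcε : 0 < (ε / Real.pi) ^ 2 := by positivity
  obtain ⟨γ, hγ0, hγ1, hγn, hTγ⟩ := exists_coarse_parameter n hn1 hcε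
  set sg : ℝ := Real.sqrt (γ / 2) with hsg
  have hsg0 : 0 < sg := Real.sqrt_pos.2 (by positivity)
  set ψ₀ : ℝ := Real.pi * sg with hψ₀
  have hψ₀0 : 0 < ψ₀ := by positivity
  set η₂ : ℝ := ψ₀ + (2 * n * Real.pi ^ (n - 1) * ψ₀) ^ ((n : ℝ)⁻¹) with hη₂
  have hη₂0 : 0 ≤ η₂ := by positivity
  set ψP : ℝ := γ / 2 with hψP
  have hψP0 : 0 ≤ ψP := by positivity
  set D : ℝ := Real.pi * sg + η₂ + γ + n * Real.sqrt (2 * γ + ψP) with hD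
  have hD0 : 0 ≤ D := by positivity
  set t' : ℝ := γ / 4 with ht'
  have ht'0 : 0 < t' := by positivity
  set ρ : ℝ := γ / (8 * (n + 1)) with hρ
  have hρ0 : 0 < ρ := by positivity
  have hρπ : ρ ≤ Real.pi := by
    have h1 : ρ ≤ γ := div_le_self hγ0.le (by linarith only [hKn])
    linarith only [h1, hγ1, Real.pi_gt_three]
  set κ : ℝ := unitSphereVolume (n - 1) * ∫ t in (0:ℝ)..ρ, Real.sin t ^ (n - 1) with hκ
  have hκ0 : 0 < κ := by
    refine mul_pos (unitSphereVolume_pos _) (intervalIntegral.intervalIntegral_pos_of_pos_on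
      ((Real.continuous_sin.pow _).intervalIntegrable _ _) (fun t ht ↦ pow_pos
        (Real.sin_pos_of_pos_of_lt_pi ht.1 (ht.2.trans_le hρπ)) _) hρ0)
  set σn : ℝ := unitSphereVolume n with hσn
  have hσ0 : 0 < σn := unitSphereVolume_pos n
  set b₇ : ℝ := t' * κ / (8 * σn) with hb₇
  have hb₇0 : 0 < b₇ := by positivity
  -- (2) the fine parameter `ε'`
  obtain ⟨ε', hε'0, c1, c2, c3, c4, c5, c6, c7, c8⟩ := exists_fine_parameter n hγ0 hsg0 hε hb₇0
  set E₄ : ℝ := 20 ^ (n + 1) * ε' with hE₄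
  have hE₄0 : 0 ≤ E₄ := by positivity
  have hE₄1 : E₄ ≤ 1 := by
    have : (20:ℝ) ^ (n + 2) * ε' = 20 * E₄ := by rw [hE₄]; ring
    linarith only [this, c1, hE₄0]
  -- (3) the deficits
  obtain ⟨δF, hδF, hF⟩ := exists_almost_orthogonal_frame n hn n le_rfl hε'0
  obtain ⟨δG, hδG, -, hG⟩ := exists_deficit_forall_good_geodesics_and_antipodes n hn (n + 2) hε'0
  set δ : ℝ := min δF (min δG (min (1 / 2) (b₇ / (n + 1)))) with hδ
  have hδ0 : 0 < δ := by positivity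
  have hδF' : δ ≤ δF := min_le_left _ _
  have hδG' : δ ≤ δG := (min_le_right _ _).trans (min_le_left _ _)
  have hδhalf : δ ≤ 1 / 2 := ((min_le_right _ _).trans (min_le_right _ _)).trans (min_le_left _ _)
  have hδb : δ ≤ b₇ / (n + 1) := ((min_le_right _ _).trans (min_le_right _ _)).trans (min_le_right _ _)
  refine ⟨δ, hδ0, ?_⟩
  intro M _ _ _ _ _ _ _ _ _ h _ hRic hvol
  -- (4) setup
  set g := PseudoRiemannianMetric.ofRiemannian h with hg_def
  set hg : g.IsRiemannian := PseudoRiemannianMetric.isRiemannian_ofRiemannian h with hg'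
  haveI : LocallyCompactSpace M := Manifold.locallyCompact_of_finiteDimensional (𝓡 n)
  haveI : T3Space M := inferInstance
  have hvolg : g.riemVolume = riemannianMeasure h := PseudoRiemannianMetric.riemVolume_eq hg
  have hUtop : riemannianMeasure h univ ≠ ⊤ := by
    rw [← hvolg]; exact g.riemVolume_univ_lt_top.ne
  haveI : IsFiniteMeasure (riemannianMeasure h) := ⟨lt_top_iff_ne_top.2 hUtop⟩
  have hmono : ∀ {δ' : ℝ}, δ ≤ δ' →
      ENNReal.ofReal ((1 - δ') * unitSphereVolume n) ≤ riemannianMeasure h univ := fun hle ↦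
    (ENNReal.ofReal_le_ofReal (mul_le_mul_of_nonneg_right (by linarith only [hle]) hσ0.le)).trans hvol
  obtain ⟨x, hx⟩ := hF M h hRic (hmono hδF')
  obtain ⟨hgood, hanti⟩ := hG M h hRic (hmono hδG')
  have hfinE : Module.finrank ℝ (EuclideanSpace ℝ (Fin n)) = n := finrank_euclideanSpace_fin
  have hdiam : ∀ y z : M, (g.edist hg y z).toReal ≤ Real.pi := by
    intro y z
    have h' := edist_le_pi_div_sqrt_of_ricci_ge_of_compactSpace g hg (by rw [hfinE]; exact hn)
      one_pos (fun x w ↦ by rw [hfinE, mul_one]; exact hRic x w) y z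
    rw [Real.sqrt_one, div_one] at h'
    exact ENNReal.toReal_le_of_le_ofReal Real.pi_pos.le h'
  have hc : IsGeodesicallyComplete g.leviCivita := hopfRinow_compact_geodesicallyComplete le_rfl hg
  -- (5) the synthetic data: good paths for `x, y`, antipodal relations
  have hgoodxy : letI := g.metricSpace hg
      ∀ y y₁ y₂ : M, ∃ (z₁ z₂ : M) (pth : ℝ → M), dist y₁ z₁ ≤ ε' ∧ dist y₂ z₂ ≤ ε' ∧
        Continuous pth ∧ pth 0 = z₁ ∧ pth 1 = z₂ ∧
        (∀ i, ∀ s ∈ Icc (0:ℝ) 1,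
          |Real.sin (dist z₁ z₂) * Real.cos (dist (x i) (pth s)) -
            (Real.sin ((1 - s) * dist z₁ z₂) * Real.cos (dist (x i) z₁) +
              Real.sin (s * dist z₁ z₂) * Real.cos (dist (x i) z₂))| ≤ ε') ∧
        (∀ s ∈ Icc (0:ℝ) 1,
          |Real.sin (dist z₁ z₂) * Real.cos (dist y (pth s)) -
            (Real.sin ((1 - s) * dist z₁ z₂) * Real.cos (dist y z₁) +
              Real.sin (s * dist z₁ z₂) * Real.cos (dist y z₂))| ≤ ε') := by
    letI := g.metricSpace hg
    intro y y₁ y₂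
    obtain ⟨z₁, z₂, pth, h1, h2, h3, h4, h5, h6⟩ :=
      good_paths_of_good_geodesics g hg hc (Fin.snoc x y) (hgood (Fin.snoc x y)) y₁ y₂
    refine ⟨z₁, z₂, pth, h1, h2, h3, h4, h5, fun i s hs ↦ ?_, fun s hs ↦ ?_⟩
    · have := h6 (Fin.castSucc i) s hs
      rwa [Fin.snoc_castSucc] at this
    · have := h6 (Fin.last (n + 1)) s hs
      rwa [Fin.snoc_last] at this
  have hgoodC4 : letI := g.metricSpace hg
      ∀ y y₁ y₂ : M, ∃ (z₁ z₂ : M) (pth : ℝ → M), dist y₁ z₁ ≤ ε' ∧ dist y₂ z₂ ≤ ε' ∧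
        pth 0 = z₁ ∧ pth 1 = z₂ ∧
        (∀ i, ∀ s ∈ Icc (0:ℝ) 1,
          |Real.sin (dist z₁ z₂) * Real.cos (dist (x i) (pth s)) -
            (Real.sin ((1 - s) * dist z₁ z₂) * Real.cos (dist (x i) z₁) +
              Real.sin (s * dist z₁ z₂) * Real.cos (dist (x i) z₂))| ≤ ε') ∧
        (∀ s ∈ Icc (0:ℝ) 1,
          |Real.sin (dist z₁ z₂) * Real.cos (dist y (pth s)) -
            (Real.sin ((1 - s) * dist z₁ z₂) * Real.cos (dist y z₁) +
              Real.sin (s * dist z₁ z₂) * Real.cos (dist y z₂))| ≤ ε') := by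
    letI := g.metricSpace hg
    intro y y₁ y₂
    obtain ⟨z₁, z₂, pth, h1, h2, -, h4, h5, h6, h7⟩ := hgoodxy y y₁ y₂
    exact ⟨z₁, z₂, pth, h1, h2, h4, h5, h6, h7⟩
  have hdiam' : letI := g.metricSpace hg; ∀ a b : M, dist a b ≤ Real.pi := hdiam
  have hx' : letI := g.metricSpace hg
      ∀ i i', i ≠ i' → |Real.cos (dist (x i) (x i'))| ≤ ε' := hx
  have hanti' : letI := g.metricSpace hg
      ∀ i, ∃ xb : M, ∀ w, |Real.cos (dist (x i) w) + Real.cos (dist xb w)| ≤ ε' := fun i ↦ hanti (x i)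
  have hanti2 : letI := g.metricSpace hg
      ∀ p q : M, Real.pi - ψ₀ ≤ dist p q →
        ∀ w, |Real.cos (dist p w) + Real.cos (dist q w)| ≤ η₂ := by
    letI := g.metricSpace hg
    intro p q hpq w
    have hpq' : ENNReal.ofReal (Real.pi - ψ₀) ≤ g.edist hg p q := ENNReal.ofReal_le_of_le_toReal hpq
    exact abs_cos_edist_add_cos_edist_le g hg hn (fun x v ↦ hRic x v) hψ₀0.le hγn hpq' w
  -- (6) Bessel: `Σ_i cos² d(x_i, w) ≤ (1 + E₄)²`
  have hBessel : letI := g.metricSpace hg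
      ∀ w : M, ∑ i, Real.cos (dist (x i) w) ^ 2 ≤ (1 + E₄) ^ 2 := by
    letI := g.metricSpace hg
    intro w
    have h1 := ColdingSynthetic.sqrt_sum_cos_sq_le_of_realization x w (E := E₄) fun c hc1 ↦
      (ColdingSynthetic.exists_cos_dist_realization x w hε'0.le hε'0.le le_rfl le_rfl le_rfl le_rfl
        c1.le hdiam' hx' hanti' (hgoodC4 w) c hc1).imp fun q hq ↦ hq.2
    have h2 : 0 ≤ ∑ i, Real.cos (dist (x i) w) ^ 2 := Finset.sum_nonneg fun i _ ↦ sq_nonneg _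
    calc ∑ i, Real.cos (dist (x i) w) ^ 2 = Real.sqrt (∑ i, Real.cos (dist (x i) w) ^ 2) ^ 2 :=
          (Real.sq_sqrt h2).symm
      _ ≤ (1 + E₄) ^ 2 := pow_le_pow_left₀ (Real.sqrt_nonneg _) h1 2
  -- (7) Parseval from below, everywhere: second moments, Markov, density, Lipschitz
  have hPar : ∀ w : M, 1 - ψP ≤ ∑ i, Real.cos ((g.edist hg (x i) w).toReal) ^ 2 := by
    set μ := riemannianMeasure h with hμ
    set F : M → ℝ := fun w ↦ ∑ i, Real.cos ((g.edist hg (x i) w).toReal) ^ 2 with hFdef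
    have hconti : ∀ i, Continuous fun w ↦ Real.cos ((g.edist hg (x i) w).toReal) ^ 2 := fun i ↦
      (Real.continuous_cos.comp (continuous_edist_toReal g hg (x i))).pow 2
    have hFcont : Continuous F := continuous_finsetSum _ fun i _ ↦ hconti i
    have hFbdd : ∀ w, F w ≤ (1 + E₄) ^ 2 := fun w ↦ hBessel w
    have hFnn : ∀ w, 0 ≤ F w := fun w ↦ Finset.sum_nonneg fun i _ ↦ sq_nonneg _
    have hinti : ∀ i, Integrable (fun w ↦ Real.cos ((g.edist hg (x i) w).toReal) ^ 2) μ := fun i ↦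
      (integrable_const (1:ℝ)).mono' (hconti i).aestronglyMeasurable (ae_of_all _ fun w ↦ by
        rw [Real.norm_eq_abs, abs_of_nonneg (sq_nonneg _)]
        exact (sq_le_one_iff_abs_le_one _).2 (Real.abs_cos_le_one _))
    have hFint : Integrable F μ :=
      (integrable_const ((1 + E₄) ^ 2)).mono' hFcont.aestronglyMeasurable (ae_of_all _ fun w ↦ by
        rw [Real.norm_eq_abs, abs_of_nonneg (hFnn w)]; exact hFbdd w)
    set Bup : ℝ := (1 + E₄) ^ 2 with hBup
    have hBup3 : Bup ≤ 1 + 3 * E₄ := by rw [hBup]; nlinarith only [hE₄0, hE₄1]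
    have hBup1 : 1 ≤ Bup := by rw [hBup]; nlinarith only [hE₄0]
    set G : M → ℝ := fun w ↦ Bup - F w with hGdef
    have hGnn : ∀ w, 0 ≤ G w := fun w ↦ by simp only [hGdef]; linarith only [hFbdd w]
    have hGint : Integrable G μ := (integrable_const Bup).sub hFint
    -- `∫ F ≥ σ − (n + 1) δ σ`
    have hFint_ge : σn - (n + 1) * δ * σn ≤ ∫ w, F w ∂μ := by
      have h1 : ∫ w, F w ∂μ = ∑ i, ∫ w, Real.cos ((g.edist hg (x i) w).toReal) ^ 2 ∂μ :=
        integral_finsetSum _ fun i _ ↦ hinti i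
      have h2 := fun i ↦ sub_le_integral_cos_sq_riemannianEDist n M h hn hRic hδ0.le hvol (x i)
      rw [h1]
      calc σn - (n + 1) * δ * σn = ∑ _i : Fin (n + 1), (σn / (n + 1) - δ * σn) := by
            rw [Finset.sum_const, Finset.card_univ, Fintype.card_fin, nsmul_eq_mul]
            push_cast
            have hn' : ((n:ℝ) + 1) ≠ 0 := by positivity
            field_simp
        _ ≤ _ := Finset.sum_le_sum fun i _ ↦ h2 i
    -- `V ≤ σ`, `V ≥ (1 − δ) σ`
    have hV : μ.real univ ≤ σn := by
      have h1 := riemVolume_univ_le_unitSphereVolume g hg hn (fun x v ↦ hRic x v)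
      rw [hvolg] at h1
      exact ENNReal.toReal_le_of_le_ofReal hσ0.le h1
    have hVge : (1 - δ) * σn ≤ μ.real univ := by
      rw [measureReal_def]
      exact (ENNReal.ofReal_le_iff_le_toReal hUtop).1 hvol
    -- Markov
    have hMarkov := mul_meas_ge_le_integral_of_nonneg (ae_of_all _ hGnn) hGint t'
    have hintG : ∫ w, G w ∂μ = Bup * μ.real univ - ∫ w, F w ∂μ := by
      simp only [hGdef]
      rw [integral_sub (integrable_const _) hFint, integral_const, smul_eq_mul, mul_comm]
    have hBV : Bup * μ.real univ ≤ Bup * σn := mul_le_mul_of_nonneg_left hV (by positivity)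
    have hBσ : Bup * σn ≤ (1 + 3 * E₄) * σn := mul_le_mul_of_nonneg_right hBup3 hσ0.le
    have hSc_real : μ.real {w | t' ≤ G w} ≤ (3 * E₄ + (n + 1) * δ) * σn / t' := by
      rw [le_div_iff₀ ht'0]
      have : (3 * E₄ + (n + 1) * δ) * σn = (1 + 3 * E₄) * σn - (σn - (n + 1) * δ * σn) := by ring
      rw [this]
      linarith only [hMarkov, hintG, hFint_ge, hBV, hBσ]
    -- the density hypothesis
    set S : Set M := {w | ¬ t' ≤ G w} with hS
    have hScompl : Sᶜ = {w | t' ≤ G w} := by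
      ext w; simp [hS]
    have hVge' : σn / 2 ≤ μ.real univ := by nlinarith only [hVge, hδhalf, hσ0]
    have hVpos : 0 < μ.real univ := by linarith only [hVge', hσ0]
    have hdens_hyp : μ Sᶜ * ENNReal.ofReal σn < μ univ * ENNReal.ofReal κ := by
      rw [hScompl]
      have h1 : μ {w | t' ≤ G w} = ENNReal.ofReal (μ.real {w | t' ≤ G w}) := by
        rw [measureReal_def, ENNReal.ofReal_toReal (measure_ne_top _ _)]
      have h2 : μ univ = ENNReal.ofReal (μ.real univ) := by
        rw [measureReal_def, ENNReal.ofReal_toReal (measure_ne_top _ _)]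
      rw [h1, h2, ← ENNReal.ofReal_mul measureReal_nonneg, ← ENNReal.ofReal_mul measureReal_nonneg,
        ENNReal.ofReal_lt_ofReal_iff (by positivity)]
      have hA : 3 * E₄ + (n + 1) * δ < t' * κ / (4 * σn) := by
        have h3 : (n + 1) * δ ≤ b₇ := by
          rw [le_div_iff₀ (by positivity)] at hδb; linarith only [hδb]
        have h4 : 2 * b₇ = t' * κ / (4 * σn) := by rw [hb₇]; field_simp; ring
        linarith only [c8, h3, h4]
      have h5 : μ.real {w | t' ≤ G w} * σn ≤ (3 * E₄ + (n + 1) * δ) * (σn * σn / t') := by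
        have := mul_le_mul_of_nonneg_right hSc_real hσ0.le
        calc μ.real {w | t' ≤ G w} * σn ≤ (3 * E₄ + (n + 1) * δ) * σn / t' * σn := this
          _ = (3 * E₄ + (n + 1) * δ) * (σn * σn / t') := by ring
      have h6 : (3 * E₄ + (n + 1) * δ) * (σn * σn / t') < t' * κ / (4 * σn) * (σn * σn / t') :=
        mul_lt_mul_of_pos_right hA (by positivity)
      have h7 : t' * κ / (4 * σn) * (σn * σn / t') = κ * σn / 4 := by
        field_simp
      have h8 : κ * σn / 4 < μ.real univ * κ := by nlinarith only [hVge', hσ0, hκ0, mul_pos hσ0 hκ0]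
      linarith only [h5, h6, h7, h8]
    have hdense : ∀ p : M, ∃ s ∈ S, g.edist hg p s ≤ ENNReal.ofReal ρ := fun p ↦
      exists_mem_edist_le_of_riemVolume_compl_mul_lt g hg hn (fun x v ↦ hRic x v) hρ0 hρπ
        (by rw [hvolg]; exact hdens_hyp) p
    -- conclusion
    intro w
    obtain ⟨s, hsS, hws⟩ := hdense w
    have hFs : Bup - t' < F s := by
      have h1 : ¬ t' ≤ G s := hsS
      push Not at h1
      simp only [hGdef] at h1
      linarith only [h1]
    have hws' : (g.edist hg w s).toReal ≤ ρ := ENNReal.toReal_le_of_le_ofReal hρ0.le hws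
    have hLip : |F w - F s| ≤ 2 * (n + 1) * (g.edist hg w s).toReal := by
      letI := g.metricSpace hg
      have := ColdingSynthetic.abs_sum_cos_sq_sub_sum_cos_sq_le x w s
      rw [Fintype.card_fin] at this
      push_cast at this
      exact this
    have hρn : 2 * (n + 1) * ρ = γ / 4 := by rw [hρ]; field_simp; ring
    have h3 := (abs_le.1 hLip).1
    have h4 : 2 * ((n : ℝ) + 1) * (g.edist hg w s).toReal ≤ 2 * (n + 1) * ρ :=
      mul_le_mul_of_nonneg_left hws' (by positivity)
    show 1 - ψP ≤ F w
    linarith only [hFs, h3, h4, hρn, hBup1, ht', hψP]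
  -- (8) the almost isometry (synthetic analysis) in the length metric space `(M, d_g)`
  letI := g.metricSpace hg
  have hP : ∀ z : M, |∑ i, Real.cos (dist (x i) z) ^ 2 - 1| ≤ ψP := by
    intro z
    have h0 : 1 - ψP ≤ ∑ i, Real.cos (dist (x i) z) ^ 2 := hPar z
    refine abs_le.2 ⟨by linarith only [h0], ?_⟩
    have h1 : ∑ i, Real.cos (dist (x i) z) ^ 2 ≤ (1 + E₄) ^ 2 := hBessel z
    have h2 : (1 + E₄) ^ 2 ≤ 1 + 3 * E₄ := by nlinarith only [hE₄0, hE₄1]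
    have h3 : 3 * E₄ ≤ ψP := by linarith only [c2, hγ0, hψP]
    linarith only [h1, h2, h3]
  have hbase : ψP + n * (n * (6 * ε' / sg) / sg ^ n) ^ 2 ≤ γ := by linarith only [c6, hψP]
  have hΨ : ∀ y z : M, |Real.cos (dist y z) - ∑ i, Real.cos (dist (x i) y) * Real.cos (dist (x i) z)| ≤
      5 ^ (n + 1) * (D + 4 * (n + 3) * (6 * ε' / sg)) := fun y z ↦
    ColdingSynthetic.abs_cos_dist_sub_sum_le x y hγ0 hγ1 hψP0 hη₂0 le_rfl hε'0.le hε'0.le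
      hε'0.le hε'0.le le_rfl le_rfl le_rfl le_rfl c4.le c5.le hbase hdiam' hx' hanti' hanti2 hP
      (hgoodxy y) z
  -- (9) the map `f = Φ/‖Φ‖`
  set Φ : M → EuclideanSpace ℝ (Fin (n + 1)) := fun w ↦ WithLp.toLp 2 (fun i ↦ Real.cos (dist (x i) w))
    with hΦ
  have hΦnorm : ∀ w, ‖Φ w‖ ^ 2 = ∑ i, Real.cos (dist (x i) w) ^ 2 := fun w ↦
    ColdingSynthetic.norm_toLp_sq _
  have hΦinner : ∀ a b, ⟪Φ a, Φ b⟫ = ∑ i, Real.cos (dist (x i) a) * Real.cos (dist (x i) b) :=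
    fun a b ↦ ColdingSynthetic.inner_toLp_toLp _ _
  have hψPhalf : ψP ≤ 1 / 2 := by rw [hψP]; linarith
  have hΦpos : ∀ w, 0 < ‖Φ w‖ := by
    intro w
    have h1 : 1 - ψP ≤ ‖Φ w‖ ^ 2 := by rw [hΦnorm]; exact hPar w
    have h2 : 0 < ‖Φ w‖ ^ 2 := by linarith only [h1, hψPhalf]
    exact lt_of_le_of_ne (norm_nonneg _) fun h0 ↦ by rw [← h0] at h2; norm_num at h2
  set f : M → Metric.sphere (0 : EuclideanSpace ℝ (Fin (n + 1))) 1 := fun w ↦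
    ⟨(‖Φ w‖)⁻¹ • Φ w, by
      rw [mem_sphere_zero_iff_norm, norm_smul, norm_inv, norm_norm, inv_mul_cancel₀ (hΦpos w).ne']⟩
    with hf
  have hfval : ∀ w, (f w : EuclideanSpace ℝ (Fin (n + 1))) = (‖Φ w‖)⁻¹ • Φ w := fun w ↦ rfl
  have hangle_ff : ∀ a b, angle (f a : EuclideanSpace ℝ (Fin (n + 1))) (f b) = angle (Φ a) (Φ b) := by
    intro a b
    rw [hfval, hfval, angle_smul_left_of_pos _ _ (inv_pos.2 (hΦpos a)),
      angle_smul_right_of_pos _ _ (inv_pos.2 (hΦpos b))]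
  -- (10) distortion
  have hT' : 5 ^ (n + 1) * D + 2 * γ < (ε / Real.pi) ^ 2 := hTγ
  have hΨT : 5 ^ (n + 1) * (D + 4 * (n + 3) * (6 * ε' / sg)) + ψP ≤ 5 ^ (n + 1) * D + 2 * γ := by
    rw [mul_add]
    linarith only [c7, hγ0, hψP]
  have hdistI : ∀ a b : M, |angle (f a : EuclideanSpace ℝ (Fin (n + 1))) (f b) -
      (g.edist hg a b).toReal| ≤ ε := by
    intro a b
    rw [hangle_ff]
    have hu : |‖Φ a‖ ^ 2 - 1| ≤ ψP := by rw [hΦnorm]; exact hP a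
    have hv : |‖Φ b‖ ^ 2 - 1| ≤ ψP := by rw [hΦnorm]; exact hP b
    have huv : |⟪Φ a, Φ b⟫ - Real.cos (dist a b)| ≤ 5 ^ (n + 1) * (D + 4 * (n + 3) * (6 * ε' / sg)) := by
      rw [hΦinner, abs_sub_comm]; exact hΨ a b
    have h1 := ColdingSynthetic.abs_cos_angle_sub_le hψPhalf hu hv huv (Real.abs_cos_le_one _)
    have h2 := ColdingSynthetic.abs_sub_le_pi_mul_sqrt_of_abs_cos_sub_cos_le (angle_nonneg _ _)
      (angle_le_pi _ _) dist_nonneg (hdiam' a b) h1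
    have h3 : Real.pi * Real.sqrt ((2 * (5 ^ (n + 1) * (D + 4 * (n + 3) * (6 * ε' / sg))) + 2 * ψP) / 2) ≤ ε := by
      have h4 : (2 * (5 ^ (n + 1) * (D + 4 * (n + 3) * (6 * ε' / sg))) + 2 * ψP) / 2 ≤ (ε / Real.pi) ^ 2 := by
        linarith only [hΨT, hT']
      calc Real.pi * Real.sqrt ((2 * (5 ^ (n + 1) * (D + 4 * (n + 3) * (6 * ε' / sg))) + 2 * ψP) / 2)
          ≤ Real.pi * Real.sqrt ((ε / Real.pi) ^ 2) :=
            mul_le_mul_of_nonneg_left (Real.sqrt_le_sqrt h4) Real.pi_pos.le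
        _ = ε := by rw [Real.sqrt_sq (by positivity)]; field_simp
    exact h2.trans h3
  -- (11) density of the image
  have hdenseI : ∀ yS : Metric.sphere (0 : EuclideanSpace ℝ (Fin (n + 1))) 1, ∃ a : M,
      angle (f a : EuclideanSpace ℝ (Fin (n + 1))) yS ≤ ε := by
    intro yS
    set cv : Fin (n + 1) → ℝ := WithLp.ofLp (yS : EuclideanSpace ℝ (Fin (n + 1))) with hcv
    have hyS1 : ‖(yS : EuclideanSpace ℝ (Fin (n + 1)))‖ = 1 := norm_eq_of_mem_sphere yS
    have hcv1 : ∑ i, cv i ^ 2 = 1 := by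
      have := EuclideanSpace.real_norm_sq_eq (yS : EuclideanSpace ℝ (Fin (n + 1)))
      rw [hyS1, one_pow] at this
      rw [hcv]; exact this.symm
    have hcvE : (WithLp.toLp 2 cv : EuclideanSpace ℝ (Fin (n + 1))) = (yS : EuclideanSpace ℝ (Fin (n + 1))) :=
      WithLp.toLp_ofLp 2 _
    obtain ⟨q, hq1, -⟩ := ColdingSynthetic.exists_cos_dist_realization x (x 0) hε'0.le hε'0.le
      le_rfl le_rfl le_rfl le_rfl c1.le hdiam' hx' hanti' (hgoodC4 (x 0)) cv hcv1
    refine ⟨q, ?_⟩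
    rw [hfval, angle_smul_left_of_pos _ _ (inv_pos.2 (hΦpos q))]
    have h1 : ‖Φ q - (yS : EuclideanSpace ℝ (Fin (n + 1)))‖ ≤ Real.sqrt (n + 1) * E₄ := by
      rw [← hcvE]
      have := ColdingSynthetic.norm_toLp_sub_toLp_le hE₄0 hq1
      rw [Fintype.card_fin] at this
      push_cast at this
      exact this
    exact (ColdingSynthetic.angle_le_pi_mul_of_norm_sub_le hyS1 h1).trans c3.le
  -- (12) conclusion
  letI : RiemannianBundle (fun x : M ↦ TangentSpace (𝓡 n) x) :=
    ⟨h.toContinuousRiemannianMetric.toRiemannianMetric⟩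
  obtain ⟨f', -, hf'⟩ := exists_isRoundSphereGHApprox_of_dense h (G := univ) (η := 0) (ε := ε) le_rfl
    (fun a ↦ ⟨a, mem_univ a, by rw [Manifold.riemannianEDist_self]; exact bot_le⟩) f
    (fun a _ b _ ↦ hdistI a b) (fun yS ↦ (hdenseI yS).imp fun a ha ↦ ⟨mem_univ a, ha⟩)
  refine ⟨f', ?_⟩
  simpa using hf'

end Assembly

end Literature.Geometry.Riemannian

end
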